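import Summits.QuantumFields.YangMills.Theorems.ForcedResponseSkewnessResponseLocalisationSmearedKernelPerSite
import Summits.QuantumFields.YangMills.Theorems.ForcedResponseSkewnessRunningCouplingCeilingSmearToolkit
import HarnessLib

/-!
# Route `ForcedResponseSkewness`, crux `ResponseLocalisation`, line «signed-femto-collar»: per-site tools for the SIGNED radial
# collar transfer `stub_symContactOfFemto : FBLPinnedSigR → SymNearCovLawSigR → SymContactKernelSigR`

Helper file (lead `ym-line-frs-p1` g4; `--supports stmt-QuantumFields-24869`; design of the line: width seat frs-p2 g6).

* `perSite_bound_at` — variant of `Smeared.perSite_bound` in which the exterior-uniform bound on the smeared near-pair deviation is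
  supplied AT the site (as the signed radial law `SymNearCovLaw` does, about the sharp centre) instead of being derived from a law
  quantified over all sites;
* `torusK3_swap13` — symmetry of the torus third cumulant in its first and third slots;
* `kerCov_comm` — symmetry of the conditional covariance;
* `card_filter_norm_lt_le` — at most `(2ρ+1)⁴` box sites within Euclidean distance `ρ` of a site;
* `sym_arith` — bookkeeping of the constants.

No summit is proved by any of this (leaf R2a `BalabanLadder.NT`, conditional rung line; the YM mass gap is NOT proved).
Refs: Georgii, Gibbs Measures and Phase Transitions (2011) Thm. 4.17.
-/

set_option autoImplicit false

noncomputable section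

namespace Summit.QuantumFields.YangMills.Cruxes.ResponseLocalisation.Smeared

open MeasureTheory Filter Topology
open Literature.MathematicalPhysics.QuantumFieldTheory Literature.MathematicalPhysics.QuantumLattice
open Literature.Probability.LatticeModels
open Summit.QuantumFields.YangMills.Cruxes.OSLegsFromFemtoAndGap.DlrCollarTransfer
open Summit.QuantumFields.YangMills.Cruxes.RunningCouplingCeiling.Pointwise (torusDist torusDist_le_norm_sub)
open Summit.QuantumFields.YangMills.Cruxes.ResponseLocalisation.Birth
open Summit.QuantumFields.YangMills.Cruxes.ResponseLocalisation.Femto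

variable {G : Type} [Group G] [TopologicalSpace G] [IsTopologicalGroup G] [CompactSpace G]
  [MeasurableSpace G] [BorelSpace G] [SecondCountableTopology G] (r : LatticeRep G)

omit [SecondCountableTopology G] in
/-- The torus third cumulant is symmetric in its first and third arguments. [folklore] -/
theorem torusK3_swap13 (β : ℝ) (L : ℕ) (x y z : Fin 4 → ℤ) :
    torusK3 G r β L z y x = torusK3 G r β L x y z := by
  unfold torusK3
  have e1 : (fun U : LGConfig 4 G => dens G r z U * dens G r y U * dens G r x U) =
      fun U => dens G r x U * dens G r y U * dens G r z U := by
    funext U; ring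
  have e2 : (fun U : LGConfig 4 G => dens G r z U * dens G r x U) = fun U => dens G r x U * dens G r z U := by
    funext U; ring
  have e3 : (fun U : LGConfig 4 G => dens G r z U * dens G r y U) = fun U => dens G r y U * dens G r z U := by
    funext U; ring
  have e4 : (fun U : LGConfig 4 G => dens G r y U * dens G r x U) = fun U => dens G r x U * dens G r y U := by
    funext U; ring
  rw [e1, e2, e3, e4]
  ring

omit [SecondCountableTopology G] in
/-- The conditional covariance is symmetric. [folklore] -/
theorem kerCov_comm (β : ℝ) (c : Fin 4 → ℤ) (b : ℕ) (η : LGConfig 4 G) (F H : LGConfig 4 G → ℝ) :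
    kerCov G r β c b η F H = kerCov G r β c b η H F := by
  unfold kerCov
  have e : (fun U => F U * H U) = fun U => H U * F U := by funext U; ring
  rw [e]
  ring

omit [Group G] [TopologicalSpace G] [IsTopologicalGroup G] [CompactSpace G] [MeasurableSpace G] [BorelSpace G]
  [SecondCountableTopology G] in
/-- **Counting the Euclidean near ball**: at most `(2ρ+1)⁴` sites of `box L` are within Euclidean distance `ρ` of `z`. [folklore] -/
theorem card_filter_norm_lt_le (L : ℕ) (z : Fin 4 → ℤ) {ρ : ℝ} (hρ : 0 ≤ ρ) :
    ((((box 4 L).filter fun x => ‖siteToE (x - z)‖ < ρ).card : ℕ) : ℝ) ≤ (2 * ρ + 1) ^ 4 := by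
  classical
  refine le_trans ?_ (card_filter_torusDist_lt_le L z hρ)
  have hsub : ((box 4 L).filter fun x => ‖siteToE (x - z)‖ < ρ) ⊆ ((box 4 L).filter fun x => torusDist L x z < ρ) := by
    intro x hx
    rw [Finset.mem_filter] at hx ⊢
    refine ⟨hx.1, lt_of_le_of_lt ?_ hx.2⟩
    have e : siteToE (x - z) = siteToE x - siteToE z := by ext i; simp [siteToE_apply]
    rw [e]
    exact torusDist_le_norm_sub L x z
  exact_mod_cast Finset.card_le_card hsub

omit [Group G] [TopologicalSpace G] [IsTopologicalGroup G] [CompactSpace G] [MeasurableSpace G] [BorelSpace G]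
  [SecondCountableTopology G] in
/-- Bookkeeping of the constants of the signed radial collar transfer (pure real arithmetic). [folklore] -/
theorem sym_arith (κ s t C Rf cardS M : ℝ) (hκ : 0 < κ) (hs : 0 < s) (ht : 0 < t) (hC : 0 < C) (hM : 0 < M)
    (hMinv : 1 / M ≤ 2 * t / s) (hc4 : cardS * t ^ 4 ≤ 81 * Rf ^ 4) (hcard0 : 0 ≤ cardS) (hRf0 : 0 < Rf)
    (hRf1 : Rf ≤ 1) (hRfκ : Rf ≤ κ * s ^ 12 / (81 * 2 ^ 25 * C ^ 3)) :
    4 * (C / M ^ 4) * (κ * s ^ 8 / (2 ^ 11 * C) / M ^ 4 + cardS * (1024 * C ^ 2 / M ^ 8)) ≤ κ * t ^ 8 := by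
  have hMinv0 : 0 ≤ 1 / M := by positivity
  have hRf4 : Rf ^ 4 ≤ Rf := pow_le_of_le_one hRf0.le hRf1 (by norm_num)
  have h8 : (1 / M) ^ 8 ≤ (2 * t / s) ^ 8 := pow_le_pow_left₀ hMinv0 hMinv 8
  have h12 : (1 / M) ^ 12 ≤ (2 * t / s) ^ 12 := pow_le_pow_left₀ hMinv0 hMinv 12
  have hT1 : 4 * (C / M ^ 4) * (κ * s ^ 8 / (2 ^ 11 * C) / M ^ 4) ≤ κ * t ^ 8 / 2 := by
    have e1 : 4 * (C / M ^ 4) * (κ * s ^ 8 / (2 ^ 11 * C) / M ^ 4) = κ * s ^ 8 / 2 ^ 9 * (1 / M) ^ 8 := by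
      field_simp; ring
    rw [e1]
    calc κ * s ^ 8 / 2 ^ 9 * (1 / M) ^ 8 ≤ κ * s ^ 8 / 2 ^ 9 * (2 * t / s) ^ 8 :=
          mul_le_mul_of_nonneg_left h8 (by positivity)
      _ = κ * t ^ 8 / 2 := by field_simp
  have hT2 : 4 * (C / M ^ 4) * (cardS * (1024 * C ^ 2 / M ^ 8)) ≤ κ * t ^ 8 / 2 := by
    have e1 : 4 * (C / M ^ 4) * (cardS * (1024 * C ^ 2 / M ^ 8)) = 4096 * C ^ 3 * cardS * (1 / M) ^ 12 := by
      field_simp; ring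
    rw [e1]
    have hRfκ' : 81 * 2 ^ 25 * C ^ 3 * Rf ≤ κ * s ^ 12 := by
      have := (le_div_iff₀ (by positivity : (0 : ℝ) < 81 * 2 ^ 25 * C ^ 3)).1 hRfκ
      linarith only [this]
    calc 4096 * C ^ 3 * cardS * (1 / M) ^ 12 ≤ 4096 * C ^ 3 * cardS * (2 * t / s) ^ 12 :=
          mul_le_mul_of_nonneg_left h12 (by positivity)
      _ = (cardS * t ^ 4) * (2 ^ 24 * C ^ 3 * t ^ 8 / s ^ 12) := by field_simp; ring
      _ ≤ (81 * Rf ^ 4) * (2 ^ 24 * C ^ 3 * t ^ 8 / s ^ 12) := mul_le_mul_of_nonneg_right hc4 (by positivity)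
      _ ≤ (81 * Rf) * (2 ^ 24 * C ^ 3 * t ^ 8 / s ^ 12) := by
          refine mul_le_mul_of_nonneg_right ?_ (by positivity)
          linarith only [hRf4]
      _ = (81 * 2 ^ 25 * C ^ 3 * Rf) * (t ^ 8 / (2 * s ^ 12)) := by field_simp
      _ ≤ (κ * s ^ 12) * (t ^ 8 / (2 * s ^ 12)) := mul_le_mul_of_nonneg_right hRfκ' (by positivity)
      _ = κ * t ^ 8 / 2 := by field_simp
  have e : 4 * (C / M ^ 4) * (κ * s ^ 8 / (2 ^ 11 * C) / M ^ 4 + cardS * (1024 * C ^ 2 / M ^ 8)) =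
      4 * (C / M ^ 4) * (κ * s ^ 8 / (2 ^ 11 * C) / M ^ 4) + 4 * (C / M ^ 4) * (cardS * (1024 * C ^ 2 / M ^ 8)) := by ring
  rw [e]
  linarith only [hT1, hT2]

/-- **Per-site collar bound with a smeared near observable, law supplied at the site** (variant of `Smeared.perSite_bound`):
for the site `x' = z₁ + v`, `|v_j| ≤ M/8`, weights `w_z` on sites `z ∈ S` within `M/8` of `z₁`, and an exterior-uniform bound
`Λw` on the smeared deviation `|Σ_{z∈S} w_z (kerCov_η(dens x', dens z) − n_z)|` in the radius-`M+1` cube around `z₁`: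
`|Σ_{z∈S} w_z κ₃^T(x',y,z)| ≤ 4 · (C₁+1)/M⁴ · (Λw + (Σ_z |w_z|)·1024(C₁+1)²/M⁸)`.  Georgii's conditional independence of separated
volumes, Thm. 4.17. [folklore] -/
theorem perSite_bound_at (β t ℓ₁ C₁ pβ Λw : ℝ) (L M : ℕ) (y z₁ : Fin 4 → ℤ) (wt : (Fin 4 → ℤ) → ℝ) (S : Finset (Fin 4 → ℤ))
    (nn : (Fin 4 → ℤ) → ℝ) {CA : ℝ} (hCA : ∀ (u : Fin 4 → ℤ) (U : LGConfig 4 G), |dens G r u U| ≤ CA)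
    (hC₁ : 0 ≤ C₁) (hΛw : 0 < Λw)
    (hF : ∀ (c : Fin 4 → ℤ) (b : ℕ), (b : ℝ) * t ≤ ℓ₁ → ∀ (η : LGConfig 4 G) (x : Fin 4 → ℤ),
      2 ≤ depth c b x → |kerE G r β c b η (dens G r x) - pβ| ≤ C₁ / (depth c b x : ℝ) ^ 4)
    (hM4 : 4 ≤ M) (hb₁ : ((2 * M + 3 : ℕ) : ℝ) * t ≤ ℓ₁) (h4M : 4 * M + 8 ≤ L)
    (hsep_yz : ∃ k : Fin 4, (2 * (M : ℤ) + 4) ≤ |((((y k - z₁ k : ℤ) : ZMod (2 * L + 1))).valMinAbs : ℤ)|)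
    (hsep_zy : ∃ k : Fin 4, (2 * (M : ℤ) + 4) ≤ |((((z₁ k - y k : ℤ) : ZMod (2 * L + 1))).valMinAbs : ℤ)|)
    (hSz : ∀ z ∈ S, ∀ j, |(z - z₁) j| ≤ ((M / 8 : ℕ) : ℤ))
    (v : Fin 4 → ℤ) (hv : ∀ j, |v j| ≤ ((M / 8 : ℕ) : ℤ))
    (hlaw : ∀ (η : LGConfig 4 G),
      |∑ z ∈ S, wt z * (kerCov G r β (fun k => z₁ k - (M + 1)) (2 * M + 3) η (dens G r (z₁ + v)) (dens G r z) - nn z)| ≤ Λw) :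
    |∑ z ∈ S, wt z * torusK3 G r β L (z₁ + v) y z| ≤
      4 * ((C₁ + 1) / (M : ℝ) ^ 4) * (Λw + (∑ z ∈ S, |wt z|) * (1024 * (C₁ + 1) ^ 2 / (M : ℝ) ^ 8)) := by
  classical
  haveI : NeZero (2 * L + 1) := ⟨by omega⟩
  have hM1 : 1 ≤ M := by omega
  have hM4r : (4 : ℝ) ≤ M := by exact_mod_cast hM4
  have hMpos : (0 : ℝ) < M := by linarith only [hM4r]
  have hC₁le : C₁ ≤ C₁ + 1 := by linarith only
  have hC₁'0 : (0 : ℝ) < C₁ + 1 := by linarith only [hC₁]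
  have hN8 : 2 * (M / 8) ≤ M := by omega
  -- the cubes, injectivity and far conditions
  set Qy : Finset (Literature.MathematicalPhysics.QuantumLattice.ZdEdge 4) :=
    cubeEdges (fun k => y k - (M + 1)) (2 * M + 3) with hQy
  set Qz : Finset (Literature.MathematicalPhysics.QuantumLattice.ZdEdge 4) :=
    cubeEdges (fun k => z₁ k - (M + 1)) (2 * M + 3) with hQz
  have hinj_y := injOn_torusProj_cube h4M y
  have hinj_z := injOn_torusProj_cube h4M z₁
  have hfar_yz : ∀ e ∈ Qz ∪ (plaquettesTouching Qz).biUnion plaquetteEdges, ∀ e' ∈ Qy,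
      torusEdge (2 * L + 1) e ≠ torusEdge (2 * L + 1) e' :=
    fun e he e' he' => torusEdge_ne_cube hsep_yz he he'
  have hfar_zy : ∀ e ∈ Qy ∪ (plaquettesTouching Qy).biUnion plaquetteEdges, ∀ e' ∈ Qz,
      torusEdge (2 * L + 1) e ≠ torusEdge (2 * L + 1) e' :=
    fun e he e' he' => torusEdge_ne_cube hsep_zy he he'
  -- FBL at the far site `y` (centre of `Qy`)
  set ε₁ : ℝ := (C₁ + 1) / (M : ℝ) ^ 4 with hε₁
  have hε₁0 : 0 < ε₁ := by rw [hε₁]; positivity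
  have hyker : ∀ η, |(∫ U, dens G r y U ∂(ymSpecification r.ρ β Qy η)) - pβ| ≤ ε₁ := fun η =>
    (abs_kerE_dens_centred_sub_le r hC₁ hF hM1 hb₁ y η).trans (div_le_div_of_nonneg_right hC₁le (by positivity))
  -- near-site facts (FBL inside `Qz`)
  have hnear : ∀ u : Fin 4 → ℤ, (∀ j, |u j| ≤ ((M / 8 : ℕ) : ℤ)) →
      IsCylinder (dens G r (z₁ + u)) Qz ∧
      (M : ℝ) / 2 ≤ (depth (fun k => z₁ k - (M + 1)) (2 * M + 3) (z₁ + u) : ℝ) ∧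
      (∀ η, |kerE G r β (fun k => z₁ k - (M + 1)) (2 * M + 3) η (dens G r (z₁ + u)) - pβ| ≤ 16 * C₁ / (M : ℝ) ^ 4) ∧
      |torusE G r β L (dens G r (z₁ + u)) - pβ| ≤ 16 * C₁ / (M : ℝ) ^ 4 :=
    fun u hu => near_site_facts r hC₁ hF hCA hM4 hN8 hb₁ h4M z₁ u hu
  have hdev : ∀ u : Fin 4 → ℤ, (∀ j, |u j| ≤ ((M / 8 : ℕ) : ℤ)) → ∀ η,
      |kerE G r β (fun k => z₁ k - (M + 1)) (2 * M + 3) η (dens G r (z₁ + u)) - torusE G r β L (dens G r (z₁ + u))| ≤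
        32 * C₁ / (M : ℝ) ^ 4 := by
    intro u hu η
    obtain ⟨-, -, h1, h2⟩ := hnear u hu
    have e : kerE G r β (fun k => z₁ k - (M + 1)) (2 * M + 3) η (dens G r (z₁ + u)) - torusE G r β L (dens G r (z₁ + u)) =
        (kerE G r β (fun k => z₁ k - (M + 1)) (2 * M + 3) η (dens G r (z₁ + u)) - pβ) -
          (torusE G r β L (dens G r (z₁ + u)) - pβ) := by ring
    rw [e]
    calc _ ≤ |kerE G r β (fun k => z₁ k - (M + 1)) (2 * M + 3) η (dens G r (z₁ + u)) - pβ| +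
          |torusE G r β L (dens G r (z₁ + u)) - pβ| := abs_sub _ _
      _ ≤ 16 * C₁ / (M : ℝ) ^ 4 + 16 * C₁ / (M : ℝ) ^ 4 := add_le_add (h1 η) h2
      _ = 32 * C₁ / (M : ℝ) ^ 4 := by ring
  have hzrw : ∀ z : Fin 4 → ℤ, z₁ + (z - z₁) = z := fun z => by abel
  -- the representative `x' = z₁ + v`
  set x' : Fin 4 → ℤ := z₁ + v with hx'
  obtain ⟨hcylx', hdepthx', -, -⟩ := hnear v hv
  have hdx' := hdev v hv
  -- torus means
  set m : (Fin 4 → ℤ) → ℝ := fun z => torusE G r β L (dens G r z) with hm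
  set mx : ℝ := torusE G r β L (dens G r x') with hmx
  -- the smeared near observable
  set A₂ : LGConfig 4 G → ℝ := fun U => (dens G r x' U - mx) * ∑ z ∈ S, wt z * (dens G r z U - m z) with hA₂
  have hA₂c : Continuous A₂ :=
    ((continuous_dens r x').sub continuous_const).mul
      (continuous_finsetSum S fun z _ => continuous_const.mul ((continuous_dens r z).sub continuous_const))
  have hA₂b : ∀ U, |A₂ U| ≤ (CA + |mx|) * ∑ z ∈ S, |wt z| * (CA + |m z|) := by
    intro U
    simp only [hA₂]
    rw [abs_mul]
    have h1 : |dens G r x' U - mx| ≤ CA + |mx| := (abs_sub _ _).trans (add_le_add (hCA _ _) le_rfl)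
    have h2 : |∑ z ∈ S, wt z * (dens G r z U - m z)| ≤ ∑ z ∈ S, |wt z| * (CA + |m z|) := by
      refine (Finset.abs_sum_le_sum_abs _ _).trans (Finset.sum_le_sum fun z _ => ?_)
      rw [abs_mul]
      exact mul_le_mul_of_nonneg_left ((abs_sub _ _).trans (add_le_add (hCA _ _) le_rfl)) (abs_nonneg _)
    exact mul_le_mul h1 h2 (abs_nonneg _) ((abs_nonneg _).trans h1)
  have hA₂cyl : IsCylinder A₂ Qz := by
    intro U V hUV
    have h1 : dens G r x' U = dens G r x' V := hcylx' hUV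
    have h2 : ∀ z ∈ S, dens G r z U = dens G r z V := by
      intro z hz
      have hc := (hnear (z - z₁) (hSz z hz)).1
      rw [hzrw z] at hc
      exact hc hUV
    simp only [hA₂]
    rw [h1]
    congr 1
    exact Finset.sum_congr rfl fun z hz => by rw [h2 z hz]
  -- the kernel mean of `A₂`
  set p₂ : ℝ := ∑ z ∈ S, wt z * nn z with hp₂
  set ε₂ : ℝ := Λw + (∑ z ∈ S, |wt z|) * (1024 * (C₁ + 1) ^ 2 / (M : ℝ) ^ 8) with hε₂
  have hSw0 : 0 ≤ ∑ z ∈ S, |wt z| := Finset.sum_nonneg fun _ _ => abs_nonneg _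
  have hε₂0 : 0 < ε₂ := by
    have h3 : 0 ≤ (∑ z ∈ S, |wt z|) * (1024 * (C₁ + 1) ^ 2 / (M : ℝ) ^ 8) := mul_nonneg hSw0 (by positivity)
    rw [hε₂]; linarith only [hΛw, h3]
  have hA₂ker : ∀ η, |(∫ U, A₂ U ∂(ymSpecification r.ρ β Qz η)) - p₂| ≤ ε₂ := by
    intro η
    have h32 : (32 * C₁ / (M : ℝ) ^ 4) * (32 * C₁ / (M : ℝ) ^ 4) ≤ 1024 * (C₁ + 1) ^ 2 / (M : ℝ) ^ 8 := by
      have hc : C₁ ^ 2 ≤ (C₁ + 1) ^ 2 := pow_le_pow_left₀ hC₁ hC₁le 2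
      have e3 : (32 * C₁ / (M : ℝ) ^ 4) * (32 * C₁ / (M : ℝ) ^ 4) = 1024 * C₁ ^ 2 / (M : ℝ) ^ 8 := by
        field_simp; ring
      rw [e3]
      exact div_le_div_of_nonneg_right (by linarith only [hc]) (by positivity)
    have hdz : ∀ z ∈ S, |kerE G r β (fun k => z₁ k - (M + 1)) (2 * M + 3) η (dens G r z) - m z| ≤ 32 * C₁ / (M : ℝ) ^ 4 := by
      intro z hz
      have := hdev (z - z₁) (hSz z hz) η
      rw [hzrw z] at this
      exact this
    have h := abs_kerE_smeared_sub_le r β (fun k => z₁ k - (M + 1)) (2 * M + 3) η x' S wt mx m nn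
      (hdx' η) hdz (hlaw η)
    refine h.trans ?_
    rw [hε₂]
    have := mul_le_mul_of_nonneg_left h32 hSw0
    linarith only [this]
  -- the two-observable collar bound and the smeared identity
  have hcollar := abs_integral_two_sub_mean_le r β (L' := 2 * L + 1) Qy Qy Qz Qz (continuous_dens r y) hA₂c
    (fun U => hCA _ _) hA₂b (isCylinder_dens_cube r hM1 y) hA₂cyl hinj_y hinj_z hfar_yz hfar_zy hε₁0 hε₂0 hyker hA₂ker
  have hid := sum_mul_torusK3_eq_integral_smeared r β L x' y S wt mx m rfl (fun z _ => rfl)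
  rw [hid]
  exact hcollar

end Summit.QuantumFields.YangMills.Cruxes.ResponseLocalisation.Smeared

end
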